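import Summits.Langlands.Langlands.Theses.CMRestImageLocusSplit
import Literature.NumberTheory.Automorphic.CaraianiNewtonModularity
/-! BC3 birth skeleton for crux `FifteenLocusImQuadWitnessAutomorphy` (LOC15) of node/route `CMRestImageLocusSplit` (lens-5 g18): 5 named stubs (sorry) + ONE closed composition `FifteenLocusImQuadWitnessAutomorphy_proof` (real proof below the `have` lines). POST-BIRTH form: imports the route file and concludes the ROUTE decl by name (elaborates once Theses/CMRestImageLocusSplit.lean exists). -/
set_option linter.dupNamespace false
set_option linter.unusedVariables false
open scoped BigOperators Topology Manifold Classical MeasureTheory ProbabilityTheory Matrix InnerProductSpace ComplexConjugate ContinuousMap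
open Filter Set Function TopologicalSpace MeasureTheory
-- SKELETON SHAPE (writer-1 WORD (A)(61), bus L1461): ONE closed theorem `<Crux>_proof : <crux decl>` whose `have` lines invoke the sorried stubs; no stub is typed `… → <crux decl>`.
namespace Summit.Langlands.Langlands.Cruxes.FifteenLocusImQuadWitnessAutomorphy.Birth

/-- BC5 PLAN-ONLY RUNG (PRINT): the (b3∨s3,b5)-curves over imaginary quadratic F with X₀(15)(F) infinite whose j-invariant is RATIONAL (instance-free: c₄³ = q·Δ, q : ℚ) are modular — j ∈ {0,1728} ⇒ CM disjunct; else E_F is a quadratic twist of E₀ ⊗ F with E₀/ℚ modular (Wiles/BCDT), quadratic base change (Langlands 1980, Base change for GL(2)) + twist; non-empty in every box (X₀(15)(ℚ) ≅ ℤ/2 × ℤ/4 has four non-cuspidal points = the rational 15-isogenies, j ∈ {−5²/2, −5²·241³/2³, −5·29³/2⁵, 5·211³/2¹⁵} (conductor-50 classes and their twists)). Technique: cyclic base change + BCDT. Lies OUTSIDE S's known regime for these fields only in the sense that CN Thm 1.1 is silent there; it is print, and exercises the transport lever. -/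
theorem stub_locus15_rational_j :
    ∀ (F : Type) [Field F] [NumberField F], NumberField.IsTotallyComplex F → Module.finrank ℚ F = 2 → ¬ Finite ((⟨0, 41, 0, 400, 0⟩ : WeierstrassCurve ℚ).baseChange F).toAffine.Point → ∀ E : WeierstrassCurve (NumberField.RingOfIntegers F), E.Δ ≠ 0 → (∃ q : ℚ, (E.baseChange F).c₄ ^ 3 = algebraMap ℚ F q * (E.baseChange F).Δ) → ¬ (E.baseChange F).HasIrreducibleModPGaloisRep 5 → (¬ (E.baseChange F).HasIrreducibleModPGaloisRep 3 ∨ (∃ ρ₃ : Literature.NumberTheory.GaloisRepresentations.FramedGaloisRep F (ZMod 3) 2, (∃ e : (E.baseChange F).geomTorsion ((3 : ℕ) : ℤ) ≃+ (Fin 2 → ZMod 3), ∀ (σ : Field.absoluteGaloisGroup F) (P : (E.baseChange F).geomTorsion ((3 : ℕ) : ℤ)), e (σ • P) = ((ρ₃ σ : GL (Fin 2) (ZMod 3)) : Matrix (Fin 2) (Fin 2) (ZMod 3)) *ᵥ (e P)) ∧ (∀ σ : Field.absoluteGaloisGroup F, (ρ₃ σ : GL (Fin 2) (ZMod 3)) ∈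 Subgroup.closure ({(⟨!![1, 0; 0, 2], !![1, 0; 0, 2], by decide, by decide⟩ : GL (Fin 2) (ZMod 3)), (⟨!![0, 1; 1, 0], !![0, 1; 1, 0], by decide, by decide⟩ : GL (Fin 2) (ZMod 3))} : Set (GL (Fin 2) (ZMod 3)))) ∧ (∀ n ∈ Subgroup.closure ({(⟨!![1, 0; 0, 2], !![1, 0; 0, 2], by decide, by decide⟩ : GL (Fin 2) (ZMod 3)), (⟨!![0, 1; 1, 0], !![0, 1; 1, 0], by decide, by decide⟩ : GL (Fin 2) (ZMod 3))} : Set (GL (Fin 2) (ZMod 3))), ∃ σ : Field.absoluteGaloisGroup F, (ρ₃ σ : GL (Fin 2) (ZMod 3)) = n))) → Literature.NumberTheory.Automorphic.IsModularEllipticCurve F E := by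
  sorry

/-- THE RESIDUAL (IDEA-NEEDED · INSTRUMENTABLE per (d, j)): the (b3∨s3,b5)-curves over imaginary quadratic F with X₀(15)(F) INFINITE whose j is NOT rational are modular — infinitely many j per field (15A1(F) has positive rank), residually reducible at 3 and 5, no lifting theorem over CM fields applies (AKT23: ordinary + irreducible); levers: reducible BT lifting over CM fields, a third switch prime 7 (quadratic points of X₀(105), X(s3,b5,b7) are finite) with lifting at 7 over IQ fields, per-curve Faltings–Serre–Livné [corpus:paper-arxiv-2510.12956 p3]. -/
theorem stub_locus15_irrational_j :
    ∀ (F : Type) [Field F] [NumberField F], NumberField.IsTotallyComplex F → Module.finrank ℚ F = 2 → ¬ Finite ((⟨0, 41, 0, 400, 0⟩ : WeierstrassCurve ℚ).baseChange F).toAffine.Point → ∀ E : WeierstrassCurve (NumberField.RingOfIntegers F), E.Δ ≠ 0 → ¬ (∃ q : ℚ, (E.baseChange F).c₄ ^ 3 = algebraMap ℚ F q * (E.baseChange F).Δ) → ¬ (E.baseChange F).HasIrreducibleModPGaloisRep 5 → (¬ (E.baseChange F).HasIrreducibleModPGaloisRep 3 ∨ (∃ ρ₃ : Literature.NumberTheory.GaloisRepresentations.FramedGaloisRep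 F (ZMod 3) 2, (∃ e : (E.baseChange F).geomTorsion ((3 : ℕ) : ℤ) ≃+ (Fin 2 → ZMod 3), ∀ (σ : Field.absoluteGaloisGroup F) (P : (E.baseChange F).geomTorsion ((3 : ℕ) : ℤ)), e (σ • P) = ((ρ₃ σ : GL (Fin 2) (ZMod 3)) : Matrix (Fin 2) (Fin 2) (ZMod 3)) *ᵥ (e P)) ∧ (∀ σ : Field.absoluteGaloisGroup F, (ρ₃ σ : GL (Fin 2) (ZMod 3)) ∈ Subgroup.closure ({(⟨!![1, 0; 0, 2], !![1, 0; 0, 2], by decide, by decide⟩ : GL (Fin 2) (ZMod 3)), (⟨!![0, 1; 1, 0], !![0, 1; 1, 0], by decide, by decide⟩ : GL (Fin 2) (ZMod 3))} : Set (GL (Fin 2) (ZMod 3)))) ∧ (∀ n ∈ Subgroup.closure ({(⟨!![1, 0; 0, 2], !![1, 0; 0, 2], by decide, by decide⟩ : GL (Fin 2) (ZMod 3)), (⟨!![0, 1; 1, 0], !![0, 1; 1, 0], by decide, by decide⟩ : GL (Fin 2) (ZMod 3))} : Set (GL (Fin 2) (ZMod 3))), ∃ σ : Field.absoluteGaloisGroup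 F, (ρ₃ σ : GL (Fin 2) (ZMod 3)) = n))) → Literature.NumberTheory.Automorphic.IsModularEllipticCurve F E := by
  sorry

/-- ETP = this route's support item `CMRestImageLocusSplit.EllipticTransportPointwise` (BY NAME in the post-birth form, so the item is in the skeleton-aware cone of `closes` — BC6; text in the pre-birth form): the host transport TRANY 31038 with the witness taken through an integral model and only that curve's modularity assumed — Arthur–Clozel solvable base change of π_E along L/K₀, ⊗ the Hecke character of χ (R1), a.e. Satake match via W⁺ + Chebotarev + JS, solvable descent to K pinned by twist-primitivity (Lapid–Rogawski / Rajan). -/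
theorem stub_transport :
    Summit.Langlands.Langlands.Theses.CMRestImageLocusSplit.EllipticTransportPointwise := by
  sorry

/-- W⁺|₂ = host item `EllipticDegreeLadder.SatakeAvatarExistence` (stmt-Langlands-17415) AT n = 2, text VERBATIM the first antecedent of TRANY 31038 / ETP: every L-algebraic cuspidal π on GL₂/K has an irreducible ℓ-adic Galois avatar matching its Satake parameters a.e. (HLTT/Scholze + purity). `fun K _ _ hcpt π hL ℓ _ ι => h17415 K 2 hcpt two_pos π hL ℓ ι` closes it from the host item. -/
theorem stub_avatar2 :
    ∀ (K : Type) [Field K] [NumberField K] (hcpt : Literature.NumberTheory.Automorphic.isCompact_glFiniteIntegralLevel 2 K) (π : Literature.NumberTheory.Automorphic.CuspidalAutomorphicRepData 2 K hcpt), π.1.IsLAlgebraic → ∀ (ℓ : ℕ) [Fact ℓ.Prime] (ι : PadicAlgCl ℓ ≃+* ℂ), ∃ ρ : Literature.NumberTheory.GaloisRepresentations.FramedGaloisRep K (PadicAlgCl ℓ) 2, ρ.toGaloisRep.IsIrreducible ∧ ∀ᶠ v : IsDedekindDomain.HeightOneSpectrum (NumberField.RingOfIntegers K) in Filter.cofinite,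 SatakeFrobCompatibleAt ι π.1 ρ v := by
  sorry

/-- R1 = host item `EllipticDegreeLadder.RankOneAutomorphy` (stmt-Langlands-24805) BY NAME (cross-route by-name stub, tree precedent `stub_pairLBoundaryJS : AnalyticDescent.PairLBoundaryJS`) — automorphy of pinned-geometric ℓ-adic characters (class field theory + Weil); one proof closes both. -/
theorem stub_rankOne :
    Summit.Langlands.Langlands.Theses.EllipticDegreeLadder.RankOneAutomorphy := by
  sorry

/-- composition (real proof, no sorry outside the stubs): the stubs imply the cell. -/
theorem FifteenLocusImQuadWitnessAutomorphy_proof :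
    Summit.Langlands.Langlands.Theses.CMRestImageLocusSplit.FifteenLocusImQuadWitnessAutomorphy := by
  have hR : (∀ (F : Type) [Field F] [NumberField F], NumberField.IsTotallyComplex F → Module.finrank ℚ F = 2 → ¬ Finite ((⟨0, 41, 0, 400, 0⟩ : WeierstrassCurve ℚ).baseChange F).toAffine.Point → ∀ E : WeierstrassCurve (NumberField.RingOfIntegers F), E.Δ ≠ 0 → (∃ q : ℚ, (E.baseChange F).c₄ ^ 3 = algebraMap ℚ F q * (E.baseChange F).Δ) → ¬ (E.baseChange F).HasIrreducibleModPGaloisRep 5 → (¬ (E.baseChange F).HasIrreducibleModPGaloisRep 3 ∨ (∃ ρ₃ : Literature.NumberTheory.GaloisRepresentations.FramedGaloisRep F (ZMod 3) 2, (∃ e : (E.baseChange F).geomTorsion ((3 : ℕ) : ℤ) ≃+ (Fin 2 → ZMod 3), ∀ (σ : Field.absoluteGaloisGroup F) (P : (E.baseChange F).geomTorsion ((3 : ℕ) : ℤ)), e (σ • P) = ((ρ₃ σ : GL (Fin 2) (ZMod 3)) : Matrix (Fin 2) (Fin 2) (ZMod 3)) *ᵥ (e P)) ∧ (∀ σ :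 Field.absoluteGaloisGroup F, (ρ₃ σ : GL (Fin 2) (ZMod 3)) ∈ Subgroup.closure ({(⟨!![1, 0; 0, 2], !![1, 0; 0, 2], by decide, by decide⟩ : GL (Fin 2) (ZMod 3)), (⟨!![0, 1; 1, 0], !![0, 1; 1, 0], by decide, by decide⟩ : GL (Fin 2) (ZMod 3))} : Set (GL (Fin 2) (ZMod 3)))) ∧ (∀ n ∈ Subgroup.closure ({(⟨!![1, 0; 0, 2], !![1, 0; 0, 2], by decide, by decide⟩ : GL (Fin 2) (ZMod 3)), (⟨!![0, 1; 1, 0], !![0, 1; 1, 0], by decide, by decide⟩ : GL (Fin 2) (ZMod 3))} : Set (GL (Fin 2) (ZMod 3))), ∃ σ : Field.absoluteGaloisGroup F, (ρ₃ σ : GL (Fin 2) (ZMod 3)) = n))) → Literature.NumberTheory.Automorphic.IsModularEllipticCurve F E) := stub_locus15_rational_j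
  have hI : (∀ (F : Type) [Field F] [NumberField F], NumberField.IsTotallyComplex F → Module.finrank ℚ F = 2 → ¬ Finite ((⟨0, 41, 0, 400, 0⟩ : WeierstrassCurve ℚ).baseChange F).toAffine.Point → ∀ E : WeierstrassCurve (NumberField.RingOfIntegers F), E.Δ ≠ 0 → ¬ (∃ q : ℚ, (E.baseChange F).c₄ ^ 3 = algebraMap ℚ F q * (E.baseChange F).Δ) → ¬ (E.baseChange F).HasIrreducibleModPGaloisRep 5 → (¬ (E.baseChange F).HasIrreducibleModPGaloisRep 3 ∨ (∃ ρ₃ : Literature.NumberTheory.GaloisRepresentations.FramedGaloisRep F (ZMod 3) 2, (∃ e : (E.baseChange F).geomTorsion ((3 : ℕ) : ℤ) ≃+ (Fin 2 → ZMod 3), ∀ (σ : Field.absoluteGaloisGroup F) (P : (E.baseChange F).geomTorsion ((3 : ℕ) : ℤ)), e (σ • P) = ((ρ₃ σ : GL (Fin 2) (ZMod 3)) : Matrix (Fin 2) (Fin 2) (ZMod 3)) *ᵥ (e P)) ∧ (∀ σ : Field.absoluteGaloisGroup F, (ρ₃ σ : GL (Fin 2) (ZMod 3)) ∈ Subgroup.closure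 ({(⟨!![1, 0; 0, 2], !![1, 0; 0, 2], by decide, by decide⟩ : GL (Fin 2) (ZMod 3)), (⟨!![0, 1; 1, 0], !![0, 1; 1, 0], by decide, by decide⟩ : GL (Fin 2) (ZMod 3))} : Set (GL (Fin 2) (ZMod 3)))) ∧ (∀ n ∈ Subgroup.closure ({(⟨!![1, 0; 0, 2], !![1, 0; 0, 2], by decide, by decide⟩ : GL (Fin 2) (ZMod 3)), (⟨!![0, 1; 1, 0], !![0, 1; 1, 0], by decide, by decide⟩ : GL (Fin 2) (ZMod 3))} : Set (GL (Fin 2) (ZMod 3))), ∃ σ : Field.absoluteGaloisGroup F, (ρ₃ σ : GL (Fin 2) (ZMod 3)) = n))) → Literature.NumberTheory.Automorphic.IsModularEllipticCurve F E) := stub_locus15_irrational_j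
  have hT : (Summit.Langlands.Langlands.Theses.CMRestImageLocusSplit.EllipticTransportPointwise) := stub_transport
  have hW : (∀ (K : Type) [Field K] [NumberField K] (hcpt : Literature.NumberTheory.Automorphic.isCompact_glFiniteIntegralLevel 2 K) (π : Literature.NumberTheory.Automorphic.CuspidalAutomorphicRepData 2 K hcpt), π.1.IsLAlgebraic → ∀ (ℓ : ℕ) [Fact ℓ.Prime] (ι : PadicAlgCl ℓ ≃+* ℂ), ∃ ρ : Literature.NumberTheory.GaloisRepresentations.FramedGaloisRep K (PadicAlgCl ℓ) 2, ρ.toGaloisRep.IsIrreducible ∧ ∀ᶠ v : IsDedekindDomain.HeightOneSpectrum (NumberField.RingOfIntegers K) in Filter.cofinite, SatakeFrobCompatibleAt ι π.1 ρ v) := stub_avatar2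
  have h1 : (Summit.Langlands.Langlands.Theses.EllipticDegreeLadder.RankOneAutomorphy) := stub_rankOne
  intro K _ _ hcpt ℓ _ ι ρ hirr hgeo htw hP
  obtain ⟨-, hnfin, -, hn5, hn3, L, _, _, _, hgal, hsol, K₀, _, _, _, hgal₀, hsol₀, hcm, hd2, E, hEll, χ, hvia⟩ := hP
  have htc : NumberField.IsTotallyComplex K₀ := hcm.to_isTotallyComplex
  have hΔ : E.Δ ≠ 0 := by
    intro h0
    have hu := (E.baseChange K₀).isUnit_Δ
    simp only [WeierstrassCurve.baseChange, WeierstrassCurve.map_Δ, h0, map_zero, isUnit_zero_iff] at hu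
    exact zero_ne_one hu
  have hinf : ¬ Finite (((⟨0, 41, 0, 400, 0⟩ : WeierstrassCurve ℚ).baseChange K₀).toAffine.Point) := fun hfin =>
    hnfin ⟨L, inferInstance, inferInstance, inferInstance, hgal, hsol, K₀, inferInstance, inferInstance, inferInstance, hgal₀, hsol₀, hcm, hd2, hfin, E.baseChange K₀, hEll, χ, hvia⟩
  have hred5 : ¬ (E.baseChange K₀).HasIrreducibleModPGaloisRep 5 := fun h5 =>
    hn5 ⟨L, inferInstance, inferInstance, inferInstance, hgal, hsol, K₀, inferInstance, inferInstance, inferInstance, hgal₀, hsol₀, hcm, hd2, E, hEll, χ, h5, hvia⟩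
  have hsmall3 : ¬ (E.baseChange K₀).HasIrreducibleModPGaloisRep 3 ∨ (∃ ρ₃ : Literature.NumberTheory.GaloisRepresentations.FramedGaloisRep K₀ (ZMod 3) 2, (∃ e : (E.baseChange K₀).geomTorsion ((3 : ℕ) : ℤ) ≃+ (Fin 2 → ZMod 3), ∀ (σ : Field.absoluteGaloisGroup K₀) (P : (E.baseChange K₀).geomTorsion ((3 : ℕ) : ℤ)), e (σ • P) = ((ρ₃ σ : GL (Fin 2) (ZMod 3)) : Matrix (Fin 2) (Fin 2) (ZMod 3)) *ᵥ (e P)) ∧ (∀ σ : Field.absoluteGaloisGroup K₀, (ρ₃ σ : GL (Fin 2) (ZMod 3)) ∈ Subgroup.closure ({(⟨!![1, 0; 0, 2], !![1, 0; 0, 2], by decide, by decide⟩ : GL (Fin 2) (ZMod 3)), (⟨!![0, 1; 1, 0], !![0, 1; 1, 0], by decide, by decide⟩ : GL (Fin 2) (ZMod 3))} : Set (GL (Fin 2) (ZMod 3)))) ∧ (∀ n ∈ Subgroup.closure ({(⟨!![1, 0; 0, 2], !![1, 0; 0, 2], by decide, by decide⟩ : GL (Fin 2) (ZMod 3)), (⟨!![0,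 1; 1, 0], !![0, 1; 1, 0], by decide, by decide⟩ : GL (Fin 2) (ZMod 3))} : Set (GL (Fin 2) (ZMod 3))), ∃ σ : Field.absoluteGaloisGroup K₀, (ρ₃ σ : GL (Fin 2) (ZMod 3)) = n)) := by
    by_cases h3 : (E.baseChange K₀).HasIrreducibleModPGaloisRep 3
    · exact Or.inr (Classical.byContradiction fun hs => hn3 ⟨L, inferInstance, inferInstance, inferInstance, hgal, hsol, K₀, inferInstance, inferInstance, inferInstance, hgal₀, hsol₀, hcm, hd2, E, hEll, χ, ⟨h3, hs⟩, hvia⟩)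
    · exact Or.inl h3
  have hmod : Literature.NumberTheory.Automorphic.IsModularEllipticCurve K₀ E := by
    by_cases hj : (∃ q : ℚ, (E.baseChange K₀).c₄ ^ 3 = algebraMap ℚ K₀ q * (E.baseChange K₀).Δ)
    · exact hR K₀ htc hd2 hinf E hΔ hj hred5 hsmall3
    · exact hI K₀ htc hd2 hinf E hΔ hj hred5 hsmall3
  exact hT hW h1 K hcpt ℓ ι ρ hirr hgeo htw L hgal hsol K₀ hgal₀ hsol₀ E χ hvia hmod

end Summit.Langlands.Langlands.Cruxes.FifteenLocusImQuadWitnessAutomorphy.Birth
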